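import Literature.Computability.Complexity.OccurrenceObstructionsIP
import Literature.NumberTheory.DiophantineGeometry.SymmetricSliceCharacter
import Literature.NumberTheory.DiophantineGeometry.SymmetricGroupRepsSignTwist
import Mathlib.LinearAlgebra.Eigenspace.Charpoly
import Mathlib.GroupTheory.SpecificGroups.Alternating.Centralizer
import Mathlib.GroupTheory.Perm.Cycle.PossibleTypes
import Mathlib.RingTheory.IntegralClosure.IntegrallyClosed
import Mathlib.Algebra.GCDMonoid.IntegrallyClosed
import HarnessLib

/-!
# The square positivity `g(a × a, a × a, a × a) > 0` (Bessenrodt–Behns 2004) reduced to two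
# Murnaghan–Nakayama values, via a twisted-trace criterion for Kronecker coefficients

Topic `Literature/Computability/Complexity`; companion of `OccurrenceObstructionsIP.lean`, whose
named fact `ikenmeyerPanova2017_square_pos` ("for all positive `k`, `g(k × k, k × k, k × k) > 0`",
Ikenmeyer–Panova, Adv. Math. 319 (2017), §1.1, quoting C. Bessenrodt, C. Behns, *On the Durfee
size of Kronecker products of characters of the symmetric group and its double covers*, J. Algebra
280 (2004) 132–144, Thm. 3.1 / Cor. 3.2 and the Remark on p. 136: "this provides a positive answer
to a question posed by Vallejo, namely whether for a square partition `λ = (a^a)` the character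
`[a^a]` is a constituent in its Kronecker square `[a^a]²`") is the one ingredient of IP Lemma 4.2
that the tree does not prove. Everything in this file is PROVED (no `sorry`, no named facts).

## The printed proof and what is proved here

Bessenrodt–Behns (p. 135–136) argue inside the alternating group: for `λ = λᵀ ⊢ n` the
restriction `[λ]↓A_n = {λ}₊ + {λ}₋` splits (Clifford theory, James–Kerber 2.5.7), the two halves
differ only on the two `A_n`-classes of cycle type `h(λ) = (h₁₁, …, h_kk)` (principal hook
lengths), where their values are `(ε ± √(ε ∏ hᵢ))/2`, `ε = [λ](h(λ)) = (-1)^{(n-k)/2}`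
(Frobenius; James–Kerber 2.5.12–2.5.13, resting on the Murnaghan–Nakayama formula 2.4.7–2.4.9),
and comparing `{λ}₊²` on the two critical classes gives `[λ] ⊂ [λ]²` (Thm. 3.1, Cor. 3.2).
Neither Mathlib nor the tree has character VALUES of `S_n` (no Murnaghan–Nakayama rule, no
Frobenius formula), nor the character theory of `A_n`. This file proves the whole argument for
the squares `λ = a × a` EXCEPT two values of `χ^{a×a}` which are instances of the
Murnaghan–Nakayama rule, isolating them as the hypotheses of the final theorem:

* `h1` (James–Kerber 2.4.8, `ζ^α_{h(α)} = (-1)^{∑ᵢ (α'ᵢ - i)}`, for `α = a × a`: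
  `(-1)^{a(a-1)/2}`): `χ^{a×a}(g) = ±1` for `g` of cycle type `h(a × a) = (2a-1, 2a-3, …, 3, 1)`
  (Mathlib's `Equiv.Perm.cycleType` omits fixed points, so the type is `{3, 5, …, 2a-1}`);
* `h2` (James–Kerber 2.4.9, `ζ^α_β ≠ 0 ⇒ β ⊴ h(α)`; `a × a` has no hook longer than `2a - 1`):
  `χ^{a×a}(g) = 0` whenever `g` has a cycle of length `≥ 2a`.

The route taken avoids `A_n`, Clifford theory and the explicit values of Frobenius' theorem:

1. **Twisted-trace criterion** (`sum_map_spechtRep_eq_zero_of_kroneckerCoeff_eq_zero`,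
   `sum_trace_mul_eq_zero_of_kroneckerCoeff_eq_zero`, `kroneckerCoeff_pos_of_sum_trace_mul_ne_zero`):
   for ANY endomorphisms `A, B, C` of `S^λ, S^μ, S^ν`, if `g(λ, μ, ν) = 0` then
   `∑_σ tr(A ρ_λ σ) tr(B ρ_μ σ) tr(C ρ_ν σ) = 0`, because `∑_σ ρ_λ(σ) ⊗ ρ_μ(σ) ⊗ ρ_ν(σ)` is `d!`
   times the projection onto the `S_d`-invariants of `S^λ ⊗ S^μ ⊗ S^ν`, of dimension
   `(1/d!) ∑ χ^λ χ^μ χ^ν = g(λ, μ, ν)` (the tree's `kroneckerCoeff_eq_sum_spechtCharacter_holds`,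
   Mathlib's `Representation.card_inv_mul_sum_char_eq_finrank`).
2. **The sign-intertwiner** (`exists_sign_intertwiner`): for `λ = λᵀ` a linear involution `J` of
   `S^λ` with `J ρ(g) = sgn(g) ρ(g) J` (the tree's `spechtRepTransposeEquiv`, `S^λ ⊗ sgn ≅ S^{λᵀ}`,
   transported along `λᵀ = λ`, rescaled by Schur's lemma — Mathlib's
   `Representation.IsIrreducible.algebraMap_intertwiningMap_bijective_of_isAlgClosed` with the
   tree's `isIrreducible_spechtRep_holds`). Its twisted trace `θ(g) = tr(J ρ(g))` is the difference
   character `{λ}₊ - {λ}₋`; all we use is `θ(π g π⁻¹) = sgn(π) θ(g)` (`trace_twist_conj`), whence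
   `θ = 0` off the split classes (`trace_twist_eq_zero_of_not_centralizer_le`, with Mathlib's
   `Equiv.Perm.centralizer_le_alternating_iff`: the classes of permutations whose cycles have
   distinct odd lengths, with at most one fixed point).
3. **Integrality** (`trace_twist_ne_zero_of_character_eq`; the step (v) of James–Kerber's proof
   of 2.5.13): for even `g` with `χ(g) = ±1`, `θ(g) ≠ 0`, since
   `2 tr(ρ(g)|ker(J-1)) = χ(g) + θ(g)` (the tree's `two_mul_trace_restrict_of_involutive`) and the
   trace of an operator of finite order is an algebraic integer (`isIntegral_trace_of_pow_eq_one`)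
   while `±1/2` is not (`two_mul_ne_of_isIntegral`).
4. **Assembly** (`ikenmeyerPanova2017_square_pos_of_spechtCharacter_values`): with `A = 1`,
   `B = C = J` the criterion asks for `S₂ = ∑_g χ(g) θ(g)² ≠ 0`; by 2., `h2` and the elementary
   `eq_map_range_of_odd_nodup` (a split class of `S_{a²}` with all cycles shorter than `2a` is the
   class `K` of `h(a × a)`, as the distinct odd numbers below `2a` sum to `a²`), only `K` contributes,
   `χ` and `θ²` are constant on `K`, so `S₂ = |K| · χ(g₀) · θ(g₀)² ≠ 0` by `h1` and 3.

For general self-associated `λ` step 4 fails (e.g. `ζ^{(5,4,3,2,1)}_{(7,5,3)} = 2 ≠ 0` on a split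
class other than `h(λ) = (9,5,1)`), and the full Frobenius theorem 2.5.13 would be needed; the
reduction is specific to shapes whose largest hook exhausts the split classes, such as squares.

## References

* C. Bessenrodt, C. Behns, J. Algebra 280 (2004) 132–144, §3 (Thm. 3.1, Cor. 3.2, Remark).
  [BessenrodtBehns2004]
* G. James, A. Kerber, *The Representation Theory of the Symmetric Group*, Encyclopedia Math.
  Appl. 16 (1981): 1.2.10 (split classes), 2.4.7–2.4.9 (Murnaghan–Nakayama formula and its two
  corollaries), 2.5.7 (Clifford theory for `A_n`), 2.5.12, 2.5.13 (Frobenius' theorem and its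
  proof, steps (i) and (v)). [JamesKerber1981]
* C. Ikenmeyer, G. Panova, Adv. Math. 319 (2017), §1.1 (the square positivity). [IkenmeyerPanova2017]
* W. Fulton, J. Harris, *Representation Theory*, GTM 129, Ex. 4.51 with Cor. 2.16 (the character
  formula for Kronecker coefficients), Ex. 4.4 (c) (`V_{λ'} = V_λ ⊗ U'`). [FultonHarrisGTM129]

## Mathlib and tree

Mathlib: `Representation.card_inv_mul_sum_char_eq_finrank`, `Representation.averageMap`
(`averageMap_invariant`), `Submodule.finrank_eq_zero`, `LinearMap.trace_tensorProduct'`,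
`TensorProduct.map_comp`, `Representation.IsIrreducible.algebraMap_intertwiningMap_bijective_of_isAlgClosed`,
`IsAlgClosed.exists_pow_nat_eq`, `Module.End.trace_eq_sum_roots_charpoly_of_splits`,
`Module.End.hasEigenvalue_iff_isRoot_charpoly`, `IsIntegral.of_pow`, `IsIntegrallyClosed.isIntegral_iff`
(for `ℤ ⊂ ℚ`), `Equiv.Perm.centralizer_le_alternating_iff`, `Equiv.Perm.isConj_iff_cycleType_eq`,
`Equiv.Perm.exists_with_cycleType_iff`, `Module.End.pow_restrict`.
Tree: `kroneckerCoeff_eq_sum_spechtCharacter_holds`, `spechtRepTransposeEquiv`, `signTwist_apply`,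
`isIrreducible_spechtRep_holds`, `youngSymmetrizer_ne_zero_holds`, `youngSymmetrizer_mem_spechtIdeal`,
`spechtCharacter_conj`, `two_mul_trace_restrict_of_involutive`, `transpose_rectangle_parts`,
`Nat.Partition.rectangle`.

## Design

* Nested tensor products `S^λ ⊗ (S^μ ⊗ S^ν)` of Specht carriers: the `AddCommGroup`-level Mathlib
  API (`character`, `invariants`, `averageMap`, `finiteDimensional_submodule`) is always called with
  the carrier given explicitly (`(V := …)`), and tensor-trace lemmas are instantiated with explicit
  factors and closed by `exact` (definitional unfolding of the two instance paths), never by `rw`.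
* The two Murnaghan–Nakayama values are hypotheses of ONE theorem, stated with Mathlib's
  `Equiv.Perm.cycleType` and the tree's `spechtCharacter ℂ (Nat.Partition.rectangle a a)`; no new
  definition and no named fact is introduced (D-0026). Discharging them (from a Murnaghan–Nakayama
  rule for the tree's Specht modules) turns this file into a proof of `ikenmeyerPanova2017_square_pos`.
-/

noncomputable section

open scoped BigOperators TensorProduct

namespace Literature.Computability.Complexity

open Literature.NumberTheory.DiophantineGeometry

section Criterion

variable {d : ℕ}

/-- Trace of a triple tensor product of endomorphisms of Specht modules:
`tr(A ⊗ B ⊗ C) = tr A · tr B · tr C` (Mathlib's `LinearMap.trace_tensorProduct'`, twice).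
[folklore] -/
theorem trace_map_map_spechtIdeal (lam mu nu : Nat.Partition d)
    (A : spechtIdeal ℂ lam →ₗ[ℂ] spechtIdeal ℂ lam) (B : spechtIdeal ℂ mu →ₗ[ℂ] spechtIdeal ℂ mu)
    (C : spechtIdeal ℂ nu →ₗ[ℂ] spechtIdeal ℂ nu) :
    LinearMap.trace ℂ (↥(spechtIdeal ℂ lam) ⊗[ℂ] (↥(spechtIdeal ℂ mu) ⊗[ℂ] ↥(spechtIdeal ℂ nu)))
      (TensorProduct.map A (TensorProduct.map B C)) =
    LinearMap.trace ℂ _ A * LinearMap.trace ℂ _ B * LinearMap.trace ℂ _ C := by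
  have h1 := LinearMap.trace_tensorProduct' (R := ℂ) (M := ↥(spechtIdeal ℂ mu))
    (N := ↥(spechtIdeal ℂ nu)) B C
  have h2 := LinearMap.trace_tensorProduct' (R := ℂ) (M := ↥(spechtIdeal ℂ lam))
    (N := ↥(spechtIdeal ℂ mu) ⊗[ℂ] ↥(spechtIdeal ℂ nu)) A (TensorProduct.map B C)
  rw [h1, ← mul_assoc] at h2
  exact h2

/-- **If `g(λ, μ, ν) = 0` then `∑_{σ ∈ S_d} ρ_λ(σ) ⊗ ρ_μ(σ) ⊗ ρ_ν(σ) = 0`.** The operator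
`(1/d!) ∑_σ ρ_λ(σ) ⊗ ρ_μ(σ) ⊗ ρ_ν(σ)` is the projection of `S^λ ⊗ S^μ ⊗ S^ν` onto its `S_d`-invariants
(Mathlib's `Representation.averageMap`), whose dimension is `(1/d!) ∑_σ χ^λ χ^μ χ^ν = g(λ, μ, ν)`
(`Representation.card_inv_mul_sum_char_eq_finrank` and the character formula
`kroneckerCoeff_eq_sum_spechtCharacter_holds`, Fulton–Harris Ex. 4.51 with Cor. 2.16).
[cite: FultonHarrisGTM129, Exercise 4.51 with Corollary 2.16] -/
theorem sum_map_spechtRep_eq_zero_of_kroneckerCoeff_eq_zero (lam mu nu : Nat.Partition d)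
    (h0 : kroneckerCoeff ℂ lam mu nu = 0) :
    ∑ σ : Equiv.Perm (Fin d), TensorProduct.map (spechtRep ℂ lam σ)
      (TensorProduct.map (spechtRep ℂ mu σ) (spechtRep ℂ nu σ)) = 0 := by
  classical
  set τ := (spechtRep ℂ lam).tprod ((spechtRep ℂ mu).tprod (spechtRep ℂ nu)) with hτ
  have hcard : Nat.card (Equiv.Perm (Fin d)) = d.factorial := by
    rw [Nat.card_eq_fintype_card, Fintype.card_perm, Fintype.card_fin]
  have hne : (Nat.card (Equiv.Perm (Fin d)) : ℂ) ≠ 0 := by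
    rw [hcard]; exact_mod_cast d.factorial_ne_zero
  haveI : Invertible (Nat.card (Equiv.Perm (Fin d)) : ℂ) := invertibleOfNonzero hne
  haveI : Invertible (Fintype.card (Equiv.Perm (Fin d)) : ℂ) := by
    rw [Fintype.card_eq_nat_card]; exact invertibleOfNonzero hne
  -- `|G|⁻¹ ∑ χ_τ = dim (invariants of τ)`
  have key := Representation.card_inv_mul_sum_char_eq_finrank
    (V := ↥(spechtIdeal ℂ lam) ⊗[ℂ] (↥(spechtIdeal ℂ mu) ⊗[ℂ] ↥(spechtIdeal ℂ nu))) τ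
  -- `χ_τ = χ^λ χ^μ χ^ν`
  have hchar : ∀ g : Equiv.Perm (Fin d),
      Representation.character (V := ↥(spechtIdeal ℂ lam) ⊗[ℂ] (↥(spechtIdeal ℂ mu) ⊗[ℂ]
        ↥(spechtIdeal ℂ nu))) τ g =
      spechtCharacter ℂ lam g * spechtCharacter ℂ mu g * spechtCharacter ℂ nu g := fun g =>
    calc _ = LinearMap.trace ℂ (↥(spechtIdeal ℂ lam) ⊗[ℂ] (↥(spechtIdeal ℂ mu) ⊗[ℂ]
            ↥(spechtIdeal ℂ nu))) (TensorProduct.map (spechtRep ℂ lam g)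
              (TensorProduct.map (spechtRep ℂ mu g) (spechtRep ℂ nu g))) := rfl
      _ = _ := trace_map_map_spechtIdeal lam mu nu _ _ _
  -- the character sum vanishes
  have h3 := kroneckerCoeff_eq_sum_spechtCharacter_holds ℂ lam mu nu
  rw [h0, mul_zero, Nat.cast_zero] at h3
  simp only [hchar] at key
  rw [← h3, mul_zero, eq_comm, Nat.cast_eq_zero] at key
  -- hence the invariants of `τ` vanish, and so does the averaging operator
  haveI := FiniteDimensional.finiteDimensional_submodule (K := ℂ)
    (V := ↥(spechtIdeal ℂ lam) ⊗[ℂ] (↥(spechtIdeal ℂ mu) ⊗[ℂ] ↥(spechtIdeal ℂ nu)))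
    (Representation.invariants (V := ↥(spechtIdeal ℂ lam) ⊗[ℂ] (↥(spechtIdeal ℂ mu) ⊗[ℂ]
      ↥(spechtIdeal ℂ nu))) τ)
  have hbot := (Submodule.finrank_eq_zero (R := ℂ)
    (M := ↥(spechtIdeal ℂ lam) ⊗[ℂ] (↥(spechtIdeal ℂ mu) ⊗[ℂ] ↥(spechtIdeal ℂ nu)))).mp key
  have havg : Representation.averageMap (V := ↥(spechtIdeal ℂ lam) ⊗[ℂ] (↥(spechtIdeal ℂ mu) ⊗[ℂ]
        ↥(spechtIdeal ℂ nu))) τ = 0 := by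
    apply LinearMap.ext
    intro v
    have hv := Representation.averageMap_invariant (V := ↥(spechtIdeal ℂ lam) ⊗[ℂ]
      (↥(spechtIdeal ℂ mu) ⊗[ℂ] ↥(spechtIdeal ℂ nu))) τ v
    rw [hbot, Submodule.mem_bot] at hv
    rw [hv, LinearMap.zero_apply]
  have hexp : Representation.averageMap (V := ↥(spechtIdeal ℂ lam) ⊗[ℂ] (↥(spechtIdeal ℂ mu) ⊗[ℂ]
        ↥(spechtIdeal ℂ nu))) τ =
      ⅟(Fintype.card (Equiv.Perm (Fin d)) : ℂ) • ∑ σ : Equiv.Perm (Fin d), τ σ := by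
    simp only [Representation.averageMap, GroupAlgebra.average, map_smul, map_sum,
      Representation.asAlgebraHom_of]
  rw [havg] at hexp
  have h2 : ∑ σ : Equiv.Perm (Fin d), τ σ = 0 := by
    have := congrArg (fun f => (Fintype.card (Equiv.Perm (Fin d)) : ℂ) • f) hexp
    simp only [smul_zero, smul_smul, mul_invOf_self, one_smul] at this
    exact this.symm
  exact h2

/-- **Twisted-trace criterion for Kronecker coefficients.** If `g(λ, μ, ν) = 0` then for all
endomorphisms `A, B, C` of the Specht modules `S^λ, S^μ, S^ν`,
`∑_{σ ∈ S_d} tr(A ρ_λ(σ)) · tr(B ρ_μ(σ)) · tr(C ρ_ν(σ)) = 0`: the sum is the trace of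
`(A ⊗ B ⊗ C) ∘ ∑_σ ρ_λ(σ) ⊗ ρ_μ(σ) ⊗ ρ_ν(σ)`, and the second factor vanishes
(`sum_map_spechtRep_eq_zero_of_kroneckerCoeff_eq_zero`). For `A = B = C = 1` this is (the easy half
of) the character formula `d! g(λ, μ, ν) = ∑ χ^λ χ^μ χ^ν` (Fulton–Harris, Ex. 4.51).
[cite: FultonHarrisGTM129, Exercise 4.51 with Corollary 2.16] -/
theorem sum_trace_mul_eq_zero_of_kroneckerCoeff_eq_zero (lam mu nu : Nat.Partition d)
    (A : spechtIdeal ℂ lam →ₗ[ℂ] spechtIdeal ℂ lam) (B : spechtIdeal ℂ mu →ₗ[ℂ] spechtIdeal ℂ mu)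
    (C : spechtIdeal ℂ nu →ₗ[ℂ] spechtIdeal ℂ nu) (h0 : kroneckerCoeff ℂ lam mu nu = 0) :
    ∑ σ : Equiv.Perm (Fin d), LinearMap.trace ℂ _ (A ∘ₗ spechtRep ℂ lam σ) *
      LinearMap.trace ℂ _ (B ∘ₗ spechtRep ℂ mu σ) * LinearMap.trace ℂ _ (C ∘ₗ spechtRep ℂ nu σ) =
      0 := by
  have hmap : ∀ σ : Equiv.Perm (Fin d), LinearMap.trace ℂ _ (A ∘ₗ spechtRep ℂ lam σ) *
      LinearMap.trace ℂ _ (B ∘ₗ spechtRep ℂ mu σ) * LinearMap.trace ℂ _ (C ∘ₗ spechtRep ℂ nu σ) =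
      LinearMap.trace ℂ (↥(spechtIdeal ℂ lam) ⊗[ℂ] (↥(spechtIdeal ℂ mu) ⊗[ℂ] ↥(spechtIdeal ℂ nu)))
        (TensorProduct.map A (TensorProduct.map B C) ∘ₗ TensorProduct.map (spechtRep ℂ lam σ)
          (TensorProduct.map (spechtRep ℂ mu σ) (spechtRep ℂ nu σ))) := by
    intro σ
    rw [← TensorProduct.map_comp, ← TensorProduct.map_comp, trace_map_map_spechtIdeal]
  simp only [hmap]
  have hcomp : ∑ σ : Equiv.Perm (Fin d), TensorProduct.map A (TensorProduct.map B C) ∘ₗ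
      TensorProduct.map (spechtRep ℂ lam σ) (TensorProduct.map (spechtRep ℂ mu σ) (spechtRep ℂ nu σ)) =
      TensorProduct.map A (TensorProduct.map B C) ∘ₗ ∑ σ : Equiv.Perm (Fin d),
        TensorProduct.map (spechtRep ℂ lam σ) (TensorProduct.map (spechtRep ℂ mu σ)
          (spechtRep ℂ nu σ)) := by
    apply LinearMap.ext
    intro v
    simp only [LinearMap.coe_sum, Finset.sum_apply, LinearMap.comp_apply, map_sum]
  rw [← map_sum, hcomp, sum_map_spechtRep_eq_zero_of_kroneckerCoeff_eq_zero lam mu nu h0,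
    LinearMap.comp_zero, map_zero]

/-- **Positivity form of the twisted-trace criterion**: if
`∑_σ tr(A ρ_λ(σ)) tr(B ρ_μ(σ)) tr(C ρ_ν(σ)) ≠ 0` for some endomorphisms `A, B, C`, then
`g(λ, μ, ν) > 0`. [cite: FultonHarrisGTM129, Exercise 4.51 with Corollary 2.16] -/
theorem kroneckerCoeff_pos_of_sum_trace_mul_ne_zero (lam mu nu : Nat.Partition d)
    (A : spechtIdeal ℂ lam →ₗ[ℂ] spechtIdeal ℂ lam) (B : spechtIdeal ℂ mu →ₗ[ℂ] spechtIdeal ℂ mu)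
    (C : spechtIdeal ℂ nu →ₗ[ℂ] spechtIdeal ℂ nu)
    (h : ∑ σ : Equiv.Perm (Fin d), LinearMap.trace ℂ _ (A ∘ₗ spechtRep ℂ lam σ) *
      LinearMap.trace ℂ _ (B ∘ₗ spechtRep ℂ mu σ) * LinearMap.trace ℂ _ (C ∘ₗ spechtRep ℂ nu σ) ≠
      0) :
    0 < kroneckerCoeff ℂ lam mu nu :=
  Nat.pos_of_ne_zero fun h0 => h (sum_trace_mul_eq_zero_of_kroneckerCoeff_eq_zero lam mu nu A B C h0)

end Criterion


/-! ### Algebraic integers: traces of operators of finite order -/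

section Integrality

variable {W : Type*} [AddCommGroup W] [Module ℂ W] [FiniteDimensional ℂ W]

/-- **The trace of a complex linear operator of finite order is an algebraic integer**: its
eigenvalues are roots of unity and the trace is their sum (with multiplicities, over the roots of
the characteristic polynomial). [folklore] -/
theorem isIntegral_trace_of_pow_eq_one (T : W →ₗ[ℂ] W) {N : ℕ} (hN : 0 < N) (hT : T ^ N = 1) :
    IsIntegral ℤ (LinearMap.trace ℂ W T) := by
  rw [Module.End.trace_eq_sum_roots_charpoly_of_splits (IsAlgClosed.splits _)]
  refine IsIntegral.multiset_sum fun μ hμ => ?_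
  have hroot : T.charpoly.IsRoot μ :=
    (Polynomial.mem_roots (LinearMap.charpoly_monic T).ne_zero).mp hμ
  have hev : Module.End.HasEigenvalue T μ :=
    (Module.End.hasEigenvalue_iff_isRoot_charpoly T μ).mpr hroot
  obtain ⟨v, hv⟩ := hev.exists_hasEigenvector
  have hpow := hv.pow_apply N
  rw [hT, Module.End.one_apply] at hpow
  have hμN : μ ^ N = 1 := by
    have h1 : (μ ^ N - 1) • v = 0 := by rw [sub_smul, one_smul, ← hpow, sub_self]
    rcases smul_eq_zero.mp h1 with h | h
    · exact sub_eq_zero.mp h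
    · exact absurd h hv.2
  exact IsIntegral.of_pow hN (by rw [hμN]; exact isIntegral_one)

/-- `±1/2` is not an algebraic integer: if `t` is integral over `ℤ` then `2t ≠ ±1` (`ℤ` is
integrally closed). [folklore] -/
theorem two_mul_ne_of_isIntegral {t : ℂ} (ht : IsIntegral ℤ t) {ε : ℂ} (hε : ε = 1 ∨ ε = -1) :
    2 * t ≠ ε := by
  intro h2
  -- `t` is the image of the rational number `e/2`, `e = ±1`
  obtain ⟨e, he, rfl⟩ : ∃ e : ℤ, (e = 1 ∨ e = -1) ∧ (e : ℂ) = ε := by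
    rcases hε with rfl | rfl
    · exact ⟨1, Or.inl rfl, by norm_num⟩
    · exact ⟨-1, Or.inr rfl, by norm_num⟩
  have ht' : t = algebraMap ℚ ℂ ((e : ℚ) / 2) := by
    have h2' : t = (e : ℂ) / 2 := by rw [eq_div_iff two_ne_zero, mul_comm]; exact h2
    rw [h2', eq_ratCast, Rat.cast_div, Rat.cast_intCast, Rat.cast_ofNat]
  letI : IsIntegrallyClosed ℤ := GCDMonoid.toIsIntegrallyClosed
  rw [ht', isIntegral_algebraMap_iff (algebraMap ℚ ℂ).injective,
    IsIntegrallyClosed.isIntegral_iff] at ht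
  obtain ⟨m, hm⟩ := ht
  have hm' : (2 * m : ℚ) = e := by
    rw [show (algebraMap ℤ ℚ) m = (m : ℚ) from rfl] at hm
    rw [hm]; ring
  have h2m : 2 * m = e := by exact_mod_cast hm'
  rcases he with rfl | rfl <;> omega

end Integrality

/-! ### The twisted trace `θ(g) = tr(J ρ(g))` of a sign-intertwiner `J` -/

section TwistedTrace

variable {n : ℕ} {V : Type*} [AddCommGroup V] [Module ℂ V]
  (ρ : Representation ℂ (Equiv.Perm (Fin n)) V) (J : V →ₗ[ℂ] V)

/-- **Anti-invariance of the twisted trace.** If `J ρ(g) = sgn(g) ρ(g) J` for all `g`, then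
`θ(g) := tr(J ρ(g))` satisfies `θ(π g π⁻¹) = sgn(π) θ(g)` (cyclicity of the trace). This is the
`S_n`-conjugation behaviour of the difference character `χ₊ - χ₋` of the two halves of a
self-associated representation (James–Kerber 2.5.7, 2.5.13 (i)). [cite: JamesKerber1981, 2.5.13 proof step (i)] -/
theorem trace_twist_conj
    (hJ : ∀ g : Equiv.Perm (Fin n), J * ρ g = ((Equiv.Perm.sign g : ℤ) : ℂ) • (ρ g * J))
    (π g : Equiv.Perm (Fin n)) :
    LinearMap.trace ℂ V (J * ρ (π * g * π⁻¹)) =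
      ((Equiv.Perm.sign π : ℤ) : ℂ) * LinearMap.trace ℂ V (J * ρ g) := by
  have h1 : J * ρ (π * g * π⁻¹) = ((Equiv.Perm.sign π : ℤ) : ℂ) • (ρ π * (J * ρ g * ρ π⁻¹)) := by
    rw [map_mul, map_mul, ← mul_assoc, ← mul_assoc, hJ π, smul_mul_assoc, smul_mul_assoc,
      mul_assoc, mul_assoc, mul_assoc]
  rw [h1, map_smul, smul_eq_mul, LinearMap.trace_mul_comm, mul_assoc, ← map_mul,
    inv_mul_cancel, map_one, mul_one]

/-- If an ODD permutation commutes with `g`, the twisted trace vanishes at `g`: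
`θ(g) = θ(π g π⁻¹) = -θ(g)`. [cite: JamesKerber1981, 2.5.13 proof step (i)] -/
theorem trace_twist_eq_zero_of_commute
    (hJ : ∀ g : Equiv.Perm (Fin n), J * ρ g = ((Equiv.Perm.sign g : ℤ) : ℂ) • (ρ g * J))
    {π g : Equiv.Perm (Fin n)} (hc : π * g = g * π) (hπ : Equiv.Perm.sign π = -1) :
    LinearMap.trace ℂ V (J * ρ g) = 0 := by
  have h := trace_twist_conj ρ J hJ π g
  rw [hc, mul_inv_cancel_right, hπ, Units.val_neg, Units.val_one, Int.cast_neg, Int.cast_one,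
    neg_one_mul, eq_neg_iff_add_eq_zero, ← two_mul, mul_eq_zero] at h
  exact h.resolve_left two_ne_zero

/-- **Support of the twisted trace.** `θ(g) = 0` unless the centralizer of `g` is contained in the
alternating group, i.e. (Mathlib's `Equiv.Perm.centralizer_le_alternating_iff`)
unless the cycles of `g` have pairwise distinct odd lengths and `g` has at most one fixed point —
the split classes of `S_n` (James–Kerber 1.2.10, 2.5.13). [cite: JamesKerber1981, 2.5.13 proof step (i)] -/
theorem trace_twist_eq_zero_of_not_centralizer_le
    (hJ : ∀ g : Equiv.Perm (Fin n), J * ρ g = ((Equiv.Perm.sign g : ℤ) : ℂ) • (ρ g * J))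
    {g : Equiv.Perm (Fin n)} (h : ¬ Subgroup.centralizer {g} ≤ alternatingGroup (Fin n)) :
    LinearMap.trace ℂ V (J * ρ g) = 0 := by
  rw [SetLike.le_def, not_forall] at h
  obtain ⟨π, hπ⟩ := h
  rw [Classical.not_imp, Subgroup.mem_centralizer_singleton_iff, Equiv.Perm.mem_alternatingGroup]
    at hπ
  exact trace_twist_eq_zero_of_commute ρ J hJ hπ.1 ((Int.units_eq_one_or _).resolve_left hπ.2)

/-- **Non-vanishing of the twisted trace on the critical class** (the integrality step (v) of the
proof of Frobenius' theorem, James–Kerber 2.5.13): if `J` is moreover an involution, `g` is even and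
`χ_ρ(g) = ±1`, then `θ(g) ≠ 0`. Indeed `ρ(g)` commutes with `J` and preserves `V₊ = ker(J - 1)`,
`2 tr(ρ(g)|V₊) = χ(g) + θ(g)`, and `tr(ρ(g)|V₊)` is an algebraic integer while `±1/2` is not.
[cite: JamesKerber1981, 2.5.13 proof step (v)] -/
theorem trace_twist_ne_zero_of_character_eq [FiniteDimensional ℂ V]
    (hJ : ∀ g : Equiv.Perm (Fin n), J * ρ g = ((Equiv.Perm.sign g : ℤ) : ℂ) • (ρ g * J))
    (hJJ : J * J = 1) {g : Equiv.Perm (Fin n)} (hg : Equiv.Perm.sign g = 1)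
    (hχ : ρ.character g = 1 ∨ ρ.character g = -1) :
    LinearMap.trace ℂ V (J * ρ g) ≠ 0 := by
  intro hθ
  -- `V₊ = ker (J - 1)` is stable under `ρ g`
  set Vp : Submodule ℂ V := LinearMap.ker (J - 1) with hVp
  have hJv : ∀ v, J (J v) = v := fun v => by
    rw [← Module.End.mul_apply, hJJ, Module.End.one_apply]
  have hmem : ∀ v, v ∈ Vp ↔ J v = v := fun v => by
    rw [hVp, LinearMap.mem_ker, LinearMap.sub_apply, Module.End.one_apply, sub_eq_zero]
  have hcomm : J * ρ g = ρ g * J := by rw [hJ g, hg, Units.val_one, Int.cast_one, one_smul]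
  have hstab : ∀ v ∈ Vp, ρ g v ∈ Vp := fun v hv => by
    rw [hmem] at hv ⊢
    rw [← Module.End.mul_apply, hcomm, Module.End.mul_apply, hv]
  -- `2 tr(ρ g | V₊) = χ(g) + θ(g)`
  have h2 := two_mul_trace_restrict_of_involutive (ρ g) J hJv Vp hmem hstab
  rw [← Module.End.mul_eq_comp, LinearMap.trace_mul_comm, hθ, add_zero] at h2
  -- `tr(ρ g | V₊)` is an algebraic integer: `(ρ g | V₊) ^ (orderOf g) = 1`
  have hint : IsIntegral ℤ (LinearMap.trace ℂ Vp ((ρ g).restrict hstab)) := by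
    refine isIntegral_trace_of_pow_eq_one _ (orderOf_pos g) ?_
    rw [Module.End.pow_restrict]
    apply LinearMap.ext
    intro v
    apply Subtype.ext
    rw [LinearMap.restrict_apply]
    change ((ρ g) ^ orderOf g) (v : V) = v
    rw [← map_pow, pow_orderOf_eq_one, map_one, Module.End.one_apply]
  exact two_mul_ne_of_isIntegral hint hχ h2

end TwistedTrace


/-! ### The sign-intertwiner `J : S^λ → S^λ`, `J ρ(g) = sgn(g) ρ(g) J`, `J² = 1`, for `λ = λᵀ` -/

section SignIntertwiner

variable {d : ℕ}

/-- Transport of Specht representations along an equality of partitions. [folklore] -/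
theorem nonempty_spechtRep_equiv_of_eq {μ ν : Nat.Partition d} (h : μ = ν) :
    Nonempty ((spechtRep ℂ μ).Equiv (spechtRep ℂ ν)) := by
  subst h
  exact ⟨Representation.Equiv.refl _⟩

/-- **The sign-intertwiner of a self-associated Specht module.** For `λ = λᵀ` there is a linear
involution `J` of `S^λ` with `J ρ_λ(g) = sgn(g) ρ_λ(g) J` for all `g ∈ S_d`: compose the tree's
isomorphism `S^λ ⊗ sgn ≅ S^{λᵀ}` (`spechtRepTransposeEquiv`, Fulton–Harris Ex. 4.4 (c)) with
`λᵀ = λ`, and rescale by a square root of the scalar `J₀² ∈ ℂˣ` given by Schur's lemma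
(Mathlib's `Representation.IsIrreducible.algebraMap_intertwiningMap_bijective_of_isAlgClosed` and
the tree's `isIrreducible_spechtRep_holds`). Its `±1`-eigenspaces are the two halves
`[λ]⁺, [λ]⁻` of `[λ]↓A_d` (James–Kerber 2.5.7). [cite: JamesKerber1981, 2.5.7] -/
theorem exists_sign_intertwiner (lam : Nat.Partition d) (hT : lam.transpose = lam) :
    ∃ J : spechtIdeal ℂ lam →ₗ[ℂ] spechtIdeal ℂ lam,
      (∀ g : Equiv.Perm (Fin d), J * spechtRep ℂ lam g =
        ((Equiv.Perm.sign g : ℤ) : ℂ) • (spechtRep ℂ lam g * J)) ∧ J * J = 1 := by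
  obtain ⟨e₂⟩ := nonempty_spechtRep_equiv_of_eq (μ := lam.transpose) (ν := lam) hT
  set e := (spechtRepTransposeEquiv ℂ lam).trans e₂ with he
  set J₀ : spechtIdeal ℂ lam →ₗ[ℂ] spechtIdeal ℂ lam := e.toLinearMap with hJ₀
  -- `J₀ ρ(g) = sgn(g) ρ(g) J₀`
  have hsgn : ∀ g : Equiv.Perm (Fin d),
      ((Equiv.Perm.sign g : ℤ) : ℂ) * ((Equiv.Perm.sign g : ℤ) : ℂ) = 1 := fun g => by
    rw [← Int.cast_mul, ← Units.val_mul, Int.units_mul_self, Units.val_one, Int.cast_one]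
  have h0 : ∀ g : Equiv.Perm (Fin d), J₀ * spechtRep ℂ lam g =
      ((Equiv.Perm.sign g : ℤ) : ℂ) • (spechtRep ℂ lam g * J₀) := by
    intro g
    apply LinearMap.ext
    intro v
    have h := Representation.IntertwiningMap.isIntertwining _ _ e.toIntertwiningMap g v
    rw [signTwist_apply, LinearMap.smul_apply, map_smul] at h
    rw [Module.End.mul_apply, LinearMap.smul_apply, Module.End.mul_apply]
    have h' := congrArg (fun w => ((Equiv.Perm.sign g : ℤ) : ℂ) • w) h
    simp only [smul_smul, hsgn g, one_smul] at h'
    exact h'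
  -- Schur: `J₀² = c`
  have hF : ∀ (g : Equiv.Perm (Fin d)) (v : spechtIdeal ℂ lam),
      (J₀ * J₀) (spechtRep ℂ lam g v) = spechtRep ℂ lam g ((J₀ * J₀) v) := by
    intro g v
    have h := congrArg (fun f => f v) (show J₀ * J₀ * spechtRep ℂ lam g =
      spechtRep ℂ lam g * (J₀ * J₀) by
        rw [mul_assoc, h0 g, mul_smul_comm, ← mul_assoc, h0 g, smul_mul_assoc, smul_smul, hsgn g,
          one_smul, mul_assoc])
    simpa using h
  haveI : (spechtRep ℂ lam).IsIrreducible := isIrreducible_spechtRep_holds lam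
  set F : (spechtRep ℂ lam).IntertwiningMap (spechtRep ℂ lam) :=
    (J₀ * J₀).intertwiningMap_of_isIntertwiningMap _ _ hF with hFdef
  obtain ⟨c, hc⟩ :=
    (Representation.IsIrreducible.algebraMap_intertwiningMap_bijective_of_isAlgClosed
      (ρ := spechtRep ℂ lam)).2 F
  have hc' : ∀ v : spechtIdeal ℂ lam, J₀ (J₀ v) = c • v := fun v => by
    have h := congrArg (fun f : (spechtRep ℂ lam).IntertwiningMap (spechtRep ℂ lam) => f v) hc
    simp only [Representation.IntertwiningMap.algebraMap_apply,
      Representation.IntertwiningMap.coe_smul, Representation.IntertwiningMap.coe_one,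
      Pi.smul_apply, hFdef] at h
    exact h.symm
  -- `c ≠ 0` since `J₀` is injective and `S^λ ≠ 0`
  have hc0 : c ≠ 0 := by
    intro hc0
    have hne : youngSymmetrizer ℂ lam ≠ 0 := youngSymmetrizer_ne_zero_holds ℂ lam
    set w : spechtIdeal ℂ lam := ⟨youngSymmetrizer ℂ lam, youngSymmetrizer_mem_spechtIdeal ℂ lam⟩
    have hw : J₀ (J₀ w) = 0 := by rw [hc', hc0, zero_smul]
    have hinj : Function.Injective J₀ := e.toLinearEquiv.injective
    have h1 : J₀ w = 0 := hinj (by rw [hw, map_zero])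
    have h2 : w = 0 := hinj (by rw [h1, map_zero])
    exact hne (congrArg Subtype.val h2)
  obtain ⟨s, hs⟩ := IsAlgClosed.exists_pow_nat_eq c two_pos
  have hs0 : s ≠ 0 := by rintro rfl; exact hc0 (by rw [← hs]; ring)
  refine ⟨s⁻¹ • J₀, fun g => ?_, ?_⟩
  · rw [smul_mul_assoc, h0 g, mul_smul_comm, smul_comm]
  · apply LinearMap.ext
    intro v
    rw [Module.End.mul_apply, LinearMap.smul_apply, LinearMap.smul_apply, map_smul, hc', smul_smul,
      smul_smul, Module.End.one_apply, ← hs]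
    field_simp
    rw [one_smul]

end SignIntertwiner

/-! ### The split class `h(a × a) = (2a-1, 2a-3, …, 3, 1)` of `S_{a²}` -/

section CycleTypes

/-- `∑_{i < b} (2i + 3) = b (b + 2)`. [folklore] -/
theorem sum_map_range_two_mul_add_three (b : ℕ) :
    ((Multiset.range b).map fun i => 2 * i + 3).sum = b * (b + 2) := by
  induction b with
  | zero => simp
  | succ b ih => rw [Multiset.range_succ, Multiset.map_cons, Multiset.sum_cons, ih]; ring

/-- **The only split class of `S_{a²}` with all cycles shorter than `2a` is
`h(a × a) = (2a-1, 2a-3, …, 3, 1)`**: a multiset of pairwise distinct odd numbers in `[2, 2a)`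
whose sum is at least `a² - 1` is `{3, 5, …, 2a-1}` (in Mathlib's convention the cycle type omits
fixed points; the part `1` of `h(a × a)` is the unique fixed point). The distinct odd numbers below
`2a` sum to `a²`. [folklore] -/
theorem eq_map_range_of_odd_nodup {a : ℕ} {m : Multiset ℕ} (hodd : ∀ c ∈ m, Odd c)
    (h2 : ∀ c ∈ m, 2 ≤ c) (hnd : m.Nodup) (hsum : a * a ≤ m.sum + 1) (hlt : ∀ c ∈ m, c < 2 * a) :
    m = (Multiset.range (a - 1)).map fun i => 2 * i + 3 := by
  rcases Nat.eq_zero_or_pos a with rfl | ha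
  · simp only [Nat.zero_sub, Multiset.range_zero, Multiset.map_zero]
    exact Multiset.eq_zero_of_forall_notMem fun c hc => by have := hlt c hc; omega
  obtain ⟨b, rfl⟩ : ∃ b, a = b + 1 := ⟨a - 1, by omega⟩
  rw [Nat.add_sub_cancel]
  set H := (Multiset.range b).map fun i => 2 * i + 3 with hH
  have hsub : m ⊆ H := by
    intro c hc
    obtain ⟨k, rfl⟩ := hodd c hc
    have h2c := h2 _ hc
    have hltc := hlt _ hc
    rw [hH, Multiset.mem_map]
    exact ⟨k - 1, Multiset.mem_range.mpr (by omega), by omega⟩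
  have hle : m ≤ H := (Multiset.le_iff_subset hnd).mpr hsub
  have hHsum : H.sum = b * (b + 2) := sum_map_range_two_mul_add_three b
  obtain ⟨r, hr⟩ := Multiset.le_iff_exists_add.mp hle
  have hrsum : r.sum = 0 := by
    have h := congrArg Multiset.sum hr
    rw [Multiset.sum_add, hHsum] at h
    have h1 : (b + 1) * (b + 1) ≤ m.sum + 1 := hsum
    have h2 : (b + 1) * (b + 1) = b * (b + 2) + 1 := by ring
    omega
  have hr0 : r = 0 := by
    refine Multiset.eq_zero_of_forall_notMem fun c hc => ?_
    have hc0 : c = 0 := Multiset.sum_eq_zero_iff.mp hrsum c hc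
    have hcH : c ∈ H := by rw [hr]; exact Multiset.mem_add.mpr (Or.inr hc)
    rw [hH, Multiset.mem_map] at hcH
    obtain ⟨i, -, hi⟩ := hcH
    omega
  rw [hr, hr0, add_zero]

/-- The multiset `{3, 5, …, 2a-1}` has sum `a² - 1` (so, with one fixed point, it is the cycle
type of a permutation of `a²` letters). [folklore] -/
theorem sum_map_range_pred (a : ℕ) (ha : 0 < a) :
    ((Multiset.range (a - 1)).map fun i => 2 * i + 3).sum + 1 = a * a := by
  obtain ⟨b, rfl⟩ : ∃ b, a = b + 1 := ⟨a - 1, by omega⟩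
  rw [Nat.add_sub_cancel, sum_map_range_two_mul_add_three]
  ring

/-- Every member of `{3, 5, …, 2a-1}` is odd and at least `2`, and the multiset has no
duplicates. [folklore] -/
theorem map_range_pred_props (a : ℕ) :
    (∀ c ∈ (Multiset.range (a - 1)).map (fun i => 2 * i + 3), Odd c ∧ 2 ≤ c) ∧
      ((Multiset.range (a - 1)).map fun i => 2 * i + 3).Nodup := by
  refine ⟨fun c hc => ?_, (Multiset.nodup_range _).map fun i j h => by omega⟩
  rw [Multiset.mem_map] at hc
  obtain ⟨i, -, rfl⟩ := hc
  exact ⟨⟨i + 1, by ring⟩, by omega⟩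

end CycleTypes


/-! ### Bessenrodt–Behns for squares from two Murnaghan–Nakayama values -/

section Assembly

/-- **The square positivity `g(a × a, a × a, a × a) > 0` (Bessenrodt–Behns 2004, Cor. 3.2 and the
Remark after it; the named fact `ikenmeyerPanova2017_square_pos`) from two character values of
the Murnaghan–Nakayama rule**, namely, for `λ = a × a ⊢ a²` with principal hook lengths
`h(λ) = (2a-1, 2a-3, …, 3, 1)` (James–Kerber 2.4.8: `ζ^λ_{h(λ)} = (-1)^{∑ (λ'_i - i)} = ±1`;
`h1`, where Mathlib's `cycleType` omits the fixed point) and for permutations with a cycle longer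
than every hook of `λ` (James–Kerber 2.4.9: `ζ^λ_β ≠ 0 ⇒ β ⊴ h(λ)`, so `ζ^λ(g) = 0` if `g` has a
cycle of length `≥ 2a`; `h2`).

Proof (a reduction of Bessenrodt–Behns' `A_n`-argument, Thm. 3.1/Cor. 3.2, to these two values):
let `J` be the sign-intertwiner of `S^λ` (`exists_sign_intertwiner`) and `θ(g) = tr(J ρ_λ(g))`
the difference character of the two halves of `[λ]↓A_{a²}`. By the twisted-trace criterion
(`kroneckerCoeff_pos_of_sum_trace_mul_ne_zero` with `A = 1`, `B = C = J`) it suffices that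
`S₂ = ∑_g χ^λ(g) θ(g)² ≠ 0`. Now `θ` vanishes off the split classes
(`trace_twist_eq_zero_of_not_centralizer_le`), `χ^λ` vanishes on the split classes other than
`h(λ)` (by `h2` and `eq_map_range_of_odd_nodup`: a split class of `S_{a²}` with all cycles
shorter than `2a` is `h(λ)`), `χ^λ` and `θ²` are constant on the class `K` of `h(λ)`
(`trace_twist_conj`), so `S₂ = |K| χ^λ(h(λ)) θ(g₀)²` with `g₀ ∈ K`; finally `χ^λ(h(λ)) = ±1`
(`h1`) and `θ(g₀) ≠ 0` (`trace_twist_ne_zero_of_character_eq`, the integrality step of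
Frobenius' theorem, James–Kerber 2.5.13 (v)).
[cite: BessenrodtBehns2004, Thm. 3.1 and Cor. 3.2 with the Remark on p. 136] -/
theorem ikenmeyerPanova2017_square_pos_of_spechtCharacter_values
    (h1 : ∀ (a : ℕ) (g : Equiv.Perm (Fin (a * a))), 0 < a →
      g.cycleType = (Multiset.range (a - 1)).map (fun i => 2 * i + 3) →
      spechtCharacter ℂ (Nat.Partition.rectangle a a) g = 1 ∨
        spechtCharacter ℂ (Nat.Partition.rectangle a a) g = -1)
    (h2 : ∀ (a : ℕ) (g : Equiv.Perm (Fin (a * a))), (∃ c ∈ g.cycleType, 2 * a ≤ c) →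
      spechtCharacter ℂ (Nat.Partition.rectangle a a) g = 0) :
    ikenmeyerPanova2017_square_pos := by
  classical
  intro a ha
  set lam := Nat.Partition.rectangle a a with hlam
  have hT : lam.transpose = lam := Nat.Partition.ext (transpose_rectangle_parts a a)
  obtain ⟨J, hJ, hJJ⟩ := exists_sign_intertwiner lam hT
  obtain ⟨hHmem, hHnd⟩ := map_range_pred_props a
  have hHsum := sum_map_range_pred a ha
  set H : Multiset ℕ := (Multiset.range (a - 1)).map (fun i => 2 * i + 3) with hH
  -- a representative `g₀` of the class of `h(λ)`
  obtain ⟨g₀, hg₀⟩ := (Equiv.Perm.exists_with_cycleType_iff (Fin (a * a))).mpr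
    ⟨by rw [Fintype.card_fin]; omega, fun c hc => (hHmem c hc).2⟩
  -- the centralizer of `g₀` lies in `A_{a²}`; in particular `g₀` is even
  have hcent : Subgroup.centralizer {g₀} ≤ alternatingGroup (Fin (a * a)) := by
    rw [Equiv.Perm.centralizer_le_alternating_iff, hg₀, Fintype.card_fin]
    exact ⟨fun c hc => (hHmem c hc).1, by omega,
      fun i => Multiset.nodup_iff_count_le_one.mp hHnd i⟩
  have hsign : Equiv.Perm.sign g₀ = 1 :=
    Equiv.Perm.mem_alternatingGroup.mp (hcent (Subgroup.mem_centralizer_singleton_iff.mpr rfl))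
  -- notation
  set χ : Equiv.Perm (Fin (a * a)) → ℂ := spechtCharacter ℂ lam with hχ
  set θ : Equiv.Perm (Fin (a * a)) → ℂ := fun g => LinearMap.trace ℂ _ (J * spechtRep ℂ lam g)
    with hθ
  -- the values at `g₀`
  have hχ₀ : χ g₀ = 1 ∨ χ g₀ = -1 := h1 a g₀ ha hg₀
  have hθ₀ : θ g₀ ≠ 0 := trace_twist_ne_zero_of_character_eq (spechtRep ℂ lam) J hJ hJJ hsign hχ₀
  -- the summands of `S₂`
  have key : ∀ g : Equiv.Perm (Fin (a * a)),
      χ g * θ g * θ g = if g.cycleType = H then χ g₀ * θ g₀ * θ g₀ else 0 := by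
    intro g
    split_ifs with hg
    · -- `g` is conjugate to `g₀`
      obtain ⟨π, rfl⟩ := isConj_iff.mp (Equiv.Perm.isConj_iff_cycleType_eq.mpr (hg₀.trans hg.symm))
      have hsq : ((Equiv.Perm.sign π : ℤ) : ℂ) * ((Equiv.Perm.sign π : ℤ) : ℂ) = 1 := by
        rw [← Int.cast_mul, ← Units.val_mul, Int.units_mul_self, Units.val_one, Int.cast_one]
      simp only [hχ, hθ, spechtCharacter_conj, trace_twist_conj (spechtRep ℂ lam) J hJ π g₀]
      linear_combination (χ g₀ * θ g₀ * θ g₀) * hsq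
    · by_cases hc : Subgroup.centralizer {g} ≤ alternatingGroup (Fin (a * a))
      · -- a split class other than `h(λ)`: `g` has a cycle of length `≥ 2a`, so `χ(g) = 0`
        rw [Equiv.Perm.centralizer_le_alternating_iff, Fintype.card_fin] at hc
        obtain ⟨hodd, hcard, hcount⟩ := hc
        have hlong : ∃ c ∈ g.cycleType, 2 * a ≤ c := by
          by_contra hne
          push Not at hne
          exact hg (eq_map_range_of_odd_nodup hodd (fun c hc => Equiv.Perm.two_le_of_mem_cycleType hc)
            (Multiset.nodup_iff_count_le_one.mpr hcount) hcard hne)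
        rw [show χ g = 0 from h2 a g hlong, zero_mul, zero_mul]
      · -- not a split class: `θ(g) = 0`
        rw [show θ g = 0 from trace_twist_eq_zero_of_not_centralizer_le (spechtRep ℂ lam) J hJ hc,
          mul_zero]
  -- `S₂ = |K| · χ(g₀) θ(g₀)² ≠ 0`
  apply kroneckerCoeff_pos_of_sum_trace_mul_ne_zero lam lam lam 1 J J
  have hsum : ∑ σ : Equiv.Perm (Fin (a * a)), LinearMap.trace ℂ _ ((1 : _ →ₗ[ℂ] _) ∘ₗ spechtRep ℂ lam σ) *
      LinearMap.trace ℂ _ (J ∘ₗ spechtRep ℂ lam σ) * LinearMap.trace ℂ _ (J ∘ₗ spechtRep ℂ lam σ) =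
      ∑ σ : Equiv.Perm (Fin (a * a)), χ σ * θ σ * θ σ := by
    refine Finset.sum_congr rfl fun σ _ => ?_
    rw [Module.End.one_eq_id, LinearMap.id_comp]
    rfl
  rw [hsum, Finset.sum_congr rfl fun g _ => key g, Finset.sum_ite, Finset.sum_const_zero, add_zero, Finset.sum_const, nsmul_eq_mul]
  refine mul_ne_zero ?_ (mul_ne_zero (mul_ne_zero ?_ hθ₀) hθ₀)
  · rw [Nat.cast_ne_zero, Finset.card_ne_zero]
    exact ⟨g₀, Finset.mem_filter.mpr ⟨Finset.mem_univ _, hg₀⟩⟩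
  · rcases hχ₀ with h | h <;> rw [h] <;> norm_num

end Assembly

end Literature.Computability.Complexity
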